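import Summits.CriticalPhenomena.PercolationContinuityZ3.Theses.PercNearOneGluing
import Summits.CriticalPhenomena.PercolationContinuityZ3.Theorems.PercNearOneGluingAdditiveGluingGoodBase
import Summits.CriticalPhenomena.PercolationContinuityZ3.Theorems.PercNearOneGluingAdditiveGluingLemma5AnyRelay
import Summits.CriticalPhenomena.PercolationContinuityZ3.Theorems.PercNearOneGluingAdditiveGluingGoodStepOneBond
import Summits.CriticalPhenomena.PercolationContinuityZ3.Theorems.PercNearOneGluingAdditiveGluingVariants1360
import HarnessLib

/-!
# Line `ratio-star` — the pocket/deficit RATIO is monotone under raising ANY edge at the observer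
# (Q9 designation); star induction ⇒ Q9-goodness of every vertex ⇒ `PercNearOneGluing.AdditiveGluing`
(crux item stmt-CriticalPhenomena-4576; control-strategist seat, generation 2, 2026-08-17)

Crux (FIXED, by name): `AdditiveGluing`.

## The controlling quantity and the step
For a weighting `w`, relays `A ∋ b`, an observer `o ∉ A` and a designated relay `a₀ ∈ A` put
* `τ_w(x) = μ_w(x ↔ b)`, `τ°_w(x) = μ_w(x ↔ b in {o}ᶜ)` (reliability avoiding `o`; it does not depend on the star of `o`);
* `Z_w(o) = Σ_{W ∋ o, W ∩ A = ∅} μ_w(C(o) = W) · min_{a ∈ A} μ_w(a ↔ b in Wᶜ)` (dead-pocket mass, worst selection);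
* `D_w(o) = τ_w(a₀) − τ_w(o)` (deficit of `o` behind `a₀`) and `ρ = Z / D`.
**Q9 DESIGNATION:** `a₀ ∈ argmin_A τ°_w` (Kozma–Nitzan Question 9) — invariant when the star of `o` changes.
**STUB 1 (`stub_ratioEdgeMono`, load-bearing, NEW):** for a pair `e = s(o, y)`, `y ∉ A`, with `w₀ = w[e ↦ 0]`, `w₁ = w[e ↦ 1]`:
`D_{w₀}(o) > 0 ⟹ D_{w₁}(o) · Z_{w₀}(o) ≤ D_{w₀}(o) · Z_{w₁}(o)` — raising ONE edge at a bad observer does not lower `ρ`.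
Everything is affine in the weight of `e`, so this is monotonicity of `ρ` along the whole segment.  It contains the registered
`stub_ratioMonotonePair` geometry (gluing a bad vertex `y` onto `o`) but (i) at the STAR-DELETED argmin instead of the current one and
(ii) for an observer that already carries an arbitrary partial star, and `y` may be good.
**STUB 2 (`stub_goodStaysGood`):** `D_{w₀}(o) ≤ 0 ⟹ D_{w₁}(o) ≤ 0` (a good observer stays good when an edge at it is raised; two BHK steps).
**STUB 3 (`stub_relayAttach`):** for `y ∈ A`: `τ_{w₁}(a₀) ≤ τ_{w₁}(o)` (gluing `o` onto a relay beats the `τ°`-minimiser; KN Lemma 5 summed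
over the open star of `o`).
**STAR INDUCTION (real proof `q9Good_of_stubs`):** start from `o` isolated (`K := Z − D = 0` exactly: `stub_goodBase`'s relay comparison) and raise
the pairs at `o` one at a time; the designation never moves; `K_w = (1 − w e)·K_{w₀} + (w e)·K_{w₁}` (one-bond decomposition + locality of the
pocket factor) and `K_{w₁} ≥ 0` by STUB 1 (ratio step, using `K_{w₀} ≥ 0`), STUB 2 (good case) or STUB 3 (relay pair).  Hence
`K_w(o) ≥ 0` at the Q9 designation for EVERY `o ∉ A` — no blocks, no induction on the number of vertices — and `AdditiveGluing` follows by
the level-set argument (`AdditiveGluing_of`, real proof).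
Numerics (this seat, exact partition engine): 0 violations of STUB 1 in exhaustive simple graphs n ≤ 5 (p ∈ {1/2,1/3,2/3}, all roles, all tied
designations), random weighted n ≤ 8 (all y-types), ~3 600 random-order star-induction steps, 944 adversarial climbs, and the HJ / HARD1 / R1-tie /
two-bridge families (exact rationals); the same step with the CURRENT-argmin designation fails in 2–3 % of intermediate star graphs.
Equality loci: `y` pendant on `a₀` (any weight), `y` isolated.  kit j024640 (done): EXHAUSTIVE n = 6 at p ∈ {1/2,1/3,2/3} (3.1·10⁶ instances, all
roles/ties), random-order star induction n ≤ 9 (42 349 steps), 45 517 adversarial climbs — 0 violations anywhere.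
-/

namespace Summit.CriticalPhenomena.PercolationContinuityZ3.Cruxes.AdditiveGluing.RatioStar

open MeasureTheory Set
open Literature.Probability.LatticeModels (prodBernoulli)
open Literature.Probability.Percolation (BondConfig openConn openConnIn openGraph openCluster openGraph_adj)
open Summit.CriticalPhenomena.PercolationContinuityZ3.Theorems
open scoped BigOperators Classical

noncomputable section

/-! ## STUBS -/

/-- **STUB 1 (load-bearing, NEW): one-edge ratio monotonicity at a bad observer, Q9 designation.**
`w` a weighting, `A ∋ b` relays, `o ∉ A` the observer, `y ∉ A`, `y ≠ o`, `a₀ ∈ A` a minimiser over `A` of the reliability avoiding `o`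
(`τ°`); `w₀ / w₁` = `w` with the pair `s(o, y)` closed / opened surely.  If `o` is bad in `w₀` (`τ_{w₀}(o) < τ_{w₀}(a₀)`) then
`D_{w₁}(o) · Z_{w₀}(o) ≤ D_{w₀}(o) · Z_{w₁}(o)` (the pocket factor `min_A μ(a ↔ b in Wᶜ)`, `o ∈ W`, is written under `w`; it is the same under
`w₀`, `w₁`).  Two INDUCTION HYPOTHESES are handed in for free (the composition is a double induction and supplies both; the inequality is
numerically true without them): (outer) Q9-goodness of every observer in every weighting with fewer positive-degree vertices than `w₁` — in
particular of `y` (and anyone) inside `w₀ − W` for every pocket `W ∋ o`; (inner) Q9-goodness of `o` itself in `w₀` (`D_{w₀}(o) ≤ Z_{w₀}(o)`).  One relay: Kozma–Nitzan Lemma 1 twice (proved for the glued-block form in `Cruxes/AdditiveGluing/RatioOneRelay.lean`).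
[cite: KozmaNitzan2024, §3.2 Definition p. 12, Thms 4–5 pp. 12–14, Questions 7 and 9 p. 36] -/
theorem stub_ratioEdgeMono :
    ∀ (n : ℕ) (w : Sym2 (Fin n) → unitInterval) (A : Finset (Fin n)) (o y b a₀ : Fin n) (hb : b ∈ A),
      o ∉ A → y ∉ A → y ≠ o → a₀ ∈ A →
      (∀ a ∈ A, (prodBernoulli w).real (openConnIn (({o} : Set (Fin n))ᶜ) a₀ b)
        ≤ (prodBernoulli w).real (openConnIn (({o} : Set (Fin n))ᶜ) a b)) →
      (∀ w' : Sym2 (Fin n) → unitInterval,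
        (Finset.univ.filter (fun v : Fin n => ∃ u : Fin n, 0 < (w' s(u, v) : ℝ))).card
          < (Finset.univ.filter (fun v : Fin n => ∃ u : Fin n,
              0 < ((Function.update w s(o, y) 1) s(u, v) : ℝ))).card →
        ∀ (A' : Finset (Fin n)) (o' b' a₀' : Fin n) (hb' : b' ∈ A'), o' ∉ A' → a₀' ∈ A' →
        (∀ a ∈ A', (prodBernoulli w').real (openConnIn (({o'} : Set (Fin n))ᶜ) a₀' b')
          ≤ (prodBernoulli w').real (openConnIn (({o'} : Set (Fin n))ᶜ) a b')) →
        (prodBernoulli w').real (openConn a₀' b') - (prodBernoulli w').real (openConn o' b')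
          ≤ ∑ W ∈ (Finset.univ : Finset (Finset (Fin n))).filter (fun W => o' ∈ W ∧ Disjoint W A'),
              (prodBernoulli w').real {ω : BondConfig (Fin n) | openCluster ω o' = (W : Set (Fin n))}
                * A'.inf' ⟨b', hb'⟩ (fun a => (prodBernoulli w').real (openConnIn ((W : Set (Fin n))ᶜ) a b'))) →
      ((prodBernoulli (Function.update w s(o, y) 0)).real (openConn a₀ b)
          - (prodBernoulli (Function.update w s(o, y) 0)).real (openConn o b)
        ≤ ∑ W ∈ (Finset.univ : Finset (Finset (Fin n))).filter (fun W => o ∈ W ∧ Disjoint W A),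
            (prodBernoulli (Function.update w s(o, y) 0)).real
                {ω : BondConfig (Fin n) | openCluster ω o = (W : Set (Fin n))}
              * A.inf' ⟨b, hb⟩ (fun a => (prodBernoulli w).real (openConnIn ((W : Set (Fin n))ᶜ) a b))) →
      (prodBernoulli (Function.update w s(o, y) 0)).real (openConn o b)
        < (prodBernoulli (Function.update w s(o, y) 0)).real (openConn a₀ b) →
      ((prodBernoulli (Function.update w s(o, y) 1)).real (openConn a₀ b)
          - (prodBernoulli (Function.update w s(o, y) 1)).real (openConn o b))
        * (∑ W ∈ (Finset.univ : Finset (Finset (Fin n))).filter (fun W => o ∈ W ∧ Disjoint W A),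
            (prodBernoulli (Function.update w s(o, y) 0)).real
                {ω : BondConfig (Fin n) | openCluster ω o = (W : Set (Fin n))}
              * A.inf' ⟨b, hb⟩ (fun a => (prodBernoulli w).real (openConnIn ((W : Set (Fin n))ᶜ) a b)))
      ≤ ((prodBernoulli (Function.update w s(o, y) 0)).real (openConn a₀ b)
          - (prodBernoulli (Function.update w s(o, y) 0)).real (openConn o b))
        * (∑ W ∈ (Finset.univ : Finset (Finset (Fin n))).filter (fun W => o ∈ W ∧ Disjoint W A),
            (prodBernoulli (Function.update w s(o, y) 1)).real
                {ω : BondConfig (Fin n) | openCluster ω o = (W : Set (Fin n))}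
              * A.inf' ⟨b, hb⟩ (fun a => (prodBernoulli w).real (openConnIn ((W : Set (Fin n))ᶜ) a b))) := by
  sorry

/-- **STUB 2: a good observer stays good when a pair at it is opened.**  For any vertices `o ≠ y`, `b`, `a₀`:
`τ_{w₀}(a₀) ≤ τ_{w₀}(o) ⟹ τ_{w₁}(a₀) ≤ τ_{w₁}(o)`.  Reason: with `S = {o, y}` read in `w₀`, `D(S) = μ(a₀ ↮ S)·[P(a₀ wins | a₀ ↮ S) −
P(S wins | a₀ ↮ S)]`; the first conditional probability drops (BHK 2006 Thm 1.3: `{a₀ ↔ b}` up, `{a₀ ↮ y}` down in `C(a₀)` given `a₀ ↮ o`)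
and the second rises (`winsDominate` with `η = 1{a₀ ∉ ·}`) relative to the point observer. [cite: VandenbergHaggstromKahn2005, Thm. 1.3 (p. 6), Thm. 1.4 (p. 7); KozmaNitzan2024, Lemma 1 (pp. 5–6)] -/
theorem stub_goodStaysGood :
    ∀ (n : ℕ) (w : Sym2 (Fin n) → unitInterval) (o y b a₀ : Fin n), y ≠ o →
      (prodBernoulli (Function.update w s(o, y) 0)).real (openConn a₀ b)
        ≤ (prodBernoulli (Function.update w s(o, y) 0)).real (openConn o b) →
      (prodBernoulli (Function.update w s(o, y) 1)).real (openConn a₀ b)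
        ≤ (prodBernoulli (Function.update w s(o, y) 1)).real (openConn o b) := by
  sorry

/-- **STUB 3: gluing the observer onto a relay beats the `τ°`-minimiser.**  `A ∋ b`, `o ∉ A`, `y ∈ A`, `a₀ ∈ argmin_A τ°_w`:
`τ_{w₁}(a₀) ≤ τ_{w₁}(o)` for `w₁ = w[s(o,y) ↦ 1]`.  Reason: partition by the open star `B ∋ y` of `o`; on each fibre Kozma–Nitzan's Lemma 5
(landed `stub_lemma5AnyRelay`, σ_B form, with the relay `v = y ∈ B` and `τ°(a₀) ≤ τ°(y)`) gives `μ(σ_B ∩ a₀ ↔ b) ≤ μ(σ_B ∩ o ↔ b)`; sum.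
[cite: KozmaNitzan2024, Lemma 5 p. 13 and proof of Thm 4 pp. 13–14] -/
theorem stub_relayAttach :
    ∀ (n : ℕ) (w : Sym2 (Fin n) → unitInterval) (A : Finset (Fin n)) (o y b a₀ : Fin n),
      b ∈ A → o ∉ A → y ∈ A → a₀ ∈ A →
      (∀ a ∈ A, (prodBernoulli w).real (openConnIn (({o} : Set (Fin n))ᶜ) a₀ b)
        ≤ (prodBernoulli w).real (openConnIn (({o} : Set (Fin n))ᶜ) a b)) →
      (prodBernoulli (Function.update w s(o, y) 1)).real (openConn a₀ b)
        ≤ (prodBernoulli (Function.update w s(o, y) 1)).real (openConn o b) := by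
  sorry

/-! ## Real proofs: locality, the star induction, and the crux by name -/

variable {n : ℕ}

/-- The avoiding-`o` reliability `τ°` does not depend on the weight of a pair at `o`. -/
theorem tau0_update (w : Sym2 (Fin n) → unitInterval) {o y : Fin n} (hoy : o ≠ y) (a b : Fin n) (c : unitInterval)
    (hc : c = 0 ∨ c = 1) :
    (prodBernoulli (Function.update w s(o, y) c)).real (openConnIn (({o} : Set (Fin n))ᶜ) a b)
      = (prodBernoulli w).real (openConnIn (({o} : Set (Fin n))ᶜ) a b) := by
  have hinv := goodStep_real_update_eq_of_invariant w hoy (openConnIn (({o} : Set (Fin n))ᶜ) a b)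
    (fun ω => (goodStep_openConnIn_toggle (W := ({o} : Set (Fin n))) (Set.mem_singleton o) y a b ω).1)
    (fun ω => (goodStep_openConnIn_toggle (W := ({o} : Set (Fin n))) (Set.mem_singleton o) y a b ω).2)
  rcases hc with rfl | rfl
  · exact hinv.2
  · exact hinv.1

/-- The pocket factor `μ(a ↔ b in Wᶜ)`, `o ∈ W`, does not depend on the weight of a pair at `o`. -/
theorem pocket_update (w : Sym2 (Fin n) → unitInterval) {o y : Fin n} (hoy : o ≠ y) (W : Finset (Fin n)) (hoW : o ∈ W)
    (a b : Fin n) (c : unitInterval) (hc : c = 0 ∨ c = 1) :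
    (prodBernoulli (Function.update w s(o, y) c)).real (openConnIn ((W : Set (Fin n))ᶜ) a b)
      = (prodBernoulli w).real (openConnIn ((W : Set (Fin n))ᶜ) a b) := by
  have hoW' : o ∈ (W : Set (Fin n)) := Finset.mem_coe.2 hoW
  have hinv := goodStep_real_update_eq_of_invariant w hoy (openConnIn ((W : Set (Fin n))ᶜ) a b)
    (fun ω => (goodStep_openConnIn_toggle hoW' y a b ω).1)
    (fun ω => (goodStep_openConnIn_toggle hoW' y a b ω).2)
  rcases hc with rfl | rfl
  · exact hinv.2
  · exact hinv.1


/-- `σ_∅ ⊆ {C(o) = {o}}`: with no open non-loop pair at `o`, the cluster of `o` is `{o}`. [folklore] -/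
theorem isolated_subset_cluster_singleton (o : Fin n) :
    {ω : BondConfig (Fin n) | ∀ y : Fin n, y ≠ o → s(o, y) ∉ ω} ⊆
      {ω : BondConfig (Fin n) | openCluster ω o = ((({o} : Finset (Fin n))) : Set (Fin n))} := by
  intro ω hω
  have hω : ∀ y : Fin n, y ≠ o → s(o, y) ∉ ω := hω
  show openCluster ω o = ((({o} : Finset (Fin n))) : Set (Fin n))
  rw [Finset.coe_singleton]
  ext z
  simp only [Set.mem_singleton_iff]
  constructor
  · intro hz
    by_contra hzo
    obtain ⟨z', hz'o, hz'ω, -⟩ := goodBase_exists_open_pair (show (openGraph ω).Reachable o z from hz) hzo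
    exact hω z' hz'o hz'ω
  · intro hz
    rw [hz]
    exact (SimpleGraph.Reachable.refl o : (openGraph ω).Reachable o o)

/-- **Base of the star induction**: an observer with no positive non-loop pair is (Q9-)good in success form,
`τ(a₀) − τ(o) ≤ Z(o)`, for the `τ°`-minimiser `a₀` (the relay comparison of `stub_goodBase`, KN Thm 4, with the landed Lemma 5). -/
theorem q9Good_base (w : Sym2 (Fin n) → unitInterval) (A : Finset (Fin n)) (o b a₀ : Fin n) (hb : b ∈ A)
    (ho : o ∉ A) (ha₀ : a₀ ∈ A)
    (hmin : ∀ a ∈ A, (prodBernoulli w).real (openConnIn (({o} : Set (Fin n))ᶜ) a₀ b)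
      ≤ (prodBernoulli w).real (openConnIn (({o} : Set (Fin n))ᶜ) a b))
    (hiso : ∀ y : Fin n, y ≠ o → w s(o, y) = 0) :
    (prodBernoulli w).real (openConn a₀ b) - (prodBernoulli w).real (openConn o b)
      ≤ ∑ W ∈ (Finset.univ : Finset (Finset (Fin n))).filter (fun W => o ∈ W ∧ Disjoint W A),
          (prodBernoulli w).real {ω : BondConfig (Fin n) | openCluster ω o = (W : Set (Fin n))}
            * A.inf' ⟨b, hb⟩ (fun a => (prodBernoulli w).real (openConnIn ((W : Set (Fin n))ᶜ) a b)) := by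
  have hbo : b ≠ o := fun h => ho (h ▸ hb)
  have ha₀o : a₀ ≠ o := fun h => ho (h ▸ ha₀)
  have hrel := goodBase_relay_le w A o b a₀ (stub_lemma5AnyRelay n w o b) hbo ha₀o hmin
    (fun y _ hyo => hiso y hyo)
  -- the `{o}` term of the pocket sum dominates `μ(σ_∅) · τ°(a₀)`
  have hmem : ({o} : Finset (Fin n)) ∈ (Finset.univ : Finset (Finset (Fin n))).filter
      (fun W => o ∈ W ∧ Disjoint W A) := by
    rw [Finset.mem_filter]
    exact ⟨Finset.mem_univ _, Finset.mem_singleton_self o, Finset.disjoint_singleton_left.2 ho⟩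
  have hnn : ∀ W ∈ (Finset.univ : Finset (Finset (Fin n))).filter (fun W => o ∈ W ∧ Disjoint W A),
      0 ≤ (prodBernoulli w).real {ω : BondConfig (Fin n) | openCluster ω o = (W : Set (Fin n))}
            * A.inf' ⟨b, hb⟩ (fun a => (prodBernoulli w).real (openConnIn ((W : Set (Fin n))ᶜ) a b)) :=
    fun W _ => mul_nonneg measureReal_nonneg (Finset.le_inf' _ _ fun a _ => measureReal_nonneg)
  have hsingle := Finset.single_le_sum hnn hmem
  have hinf : (prodBernoulli w).real (openConnIn (({o} : Set (Fin n))ᶜ) a₀ b) ≤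
      A.inf' ⟨b, hb⟩ (fun a => (prodBernoulli w).real
        (openConnIn (((({o} : Finset (Fin n))) : Set (Fin n))ᶜ) a b)) := by
    rw [Finset.coe_singleton]
    exact Finset.le_inf' _ _ fun a ha => hmin a ha
  have hσ : (prodBernoulli w).real {ω : BondConfig (Fin n) | ∀ y : Fin n, y ≠ o → s(o, y) ∉ ω} ≤
      (prodBernoulli w).real {ω : BondConfig (Fin n) |
        openCluster ω o = ((({o} : Finset (Fin n))) : Set (Fin n))} :=
    measureReal_mono (isolated_subset_cluster_singleton o)
  have hprod : (prodBernoulli w).real {ω : BondConfig (Fin n) | ∀ y : Fin n, y ≠ o → s(o, y) ∉ ω} *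
        (prodBernoulli w).real (openConnIn (({o} : Set (Fin n))ᶜ) a₀ b) ≤
      (prodBernoulli w).real {ω : BondConfig (Fin n) |
        openCluster ω o = ((({o} : Finset (Fin n))) : Set (Fin n))} *
        A.inf' ⟨b, hb⟩ (fun a => (prodBernoulli w).real
          (openConnIn (((({o} : Finset (Fin n))) : Set (Fin n))ᶜ) a b)) :=
    mul_le_mul hσ hinf measureReal_nonneg measureReal_nonneg
  linarith

/-- Closing a pair does not increase the number of positive-degree vertices. [folklore] -/
theorem posdeg_update_zero_le (w : Sym2 (Fin n) → unitInterval) (e : Sym2 (Fin n)) :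
    (Finset.univ.filter (fun v : Fin n => ∃ u : Fin n, 0 < ((Function.update w e 0) s(u, v) : ℝ))).card ≤
      (Finset.univ.filter (fun v : Fin n => ∃ u : Fin n, 0 < (w s(u, v) : ℝ))).card := by
  refine Finset.card_le_card fun v hv => ?_
  rw [Finset.mem_filter] at hv ⊢
  obtain ⟨u, hu⟩ := hv.2
  refine ⟨hv.1, u, ?_⟩
  by_cases he : s(u, v) = e
  · rw [he, Function.update_self] at hu
    simp at hu
  · rwa [Function.update_of_ne he] at hu

/-- Closing a pair at `o` removes one vertex from the positive open star of `o`. -/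
theorem star_card_lt (w : Sym2 (Fin n) → unitInterval) {o y : Fin n} (hyo : y ≠ o) (hy : w s(o, y) ≠ 0) :
    (Finset.univ.filter (fun z : Fin n => z ≠ o ∧ (Function.update w s(o, y) 0) s(o, z) ≠ 0)).card <
      (Finset.univ.filter (fun z : Fin n => z ≠ o ∧ w s(o, z) ≠ 0)).card := by
  apply Finset.card_lt_card
  rw [Finset.ssubset_iff_of_subset]
  · refine ⟨y, ?_, ?_⟩
    · rw [Finset.mem_filter]; exact ⟨Finset.mem_univ _, hyo, hy⟩
    · rw [Finset.mem_filter]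
      rintro ⟨-, -, h⟩
      exact h (Function.update_self _ _ _)
  · intro z hz
    rw [Finset.mem_filter] at hz ⊢
    refine ⟨Finset.mem_univ _, hz.2.1, ?_⟩
    intro h
    apply hz.2.2
    by_cases hzy : z = y
    · subst hzy; exact Function.update_self _ _ _
    · rw [Function.update_of_ne (fun h' => hzy (Sym2.congr_right.1 h'))]
      exact h


/-- **Q9-goodness of every observer, from the three stubs (the STAR INDUCTION; real proof).**  For `A ∋ b`, `o ∉ A` and a
`τ°`-minimiser `a₀ ∈ A`: `τ_w(a₀) − τ_w(o) ≤ Z_w(o)`.  Strong induction on the number of positive non-loop pairs at `o`; base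
`q9Good_base`; step: close one positive pair `s(o, y)` (the designation is unchanged, `tau0_update`), decompose every term affinely in its
weight (`goodStep_real_decomp`, `pocket_update`), use the induction hypothesis at weight `0` and the stubs at weight `1`. -/
theorem q9Good_of_stubs (h1 : (∀ (n : ℕ) (w : Sym2 (Fin n) → unitInterval) (A : Finset (Fin n)) (o y b a₀ : Fin n) (hb : b ∈ A),
      o ∉ A → y ∉ A → y ≠ o → a₀ ∈ A →
      (∀ a ∈ A, (prodBernoulli w).real (openConnIn (({o} : Set (Fin n))ᶜ) a₀ b)
        ≤ (prodBernoulli w).real (openConnIn (({o} : Set (Fin n))ᶜ) a b)) →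
      (∀ w' : Sym2 (Fin n) → unitInterval,
        (Finset.univ.filter (fun v : Fin n => ∃ u : Fin n, 0 < (w' s(u, v) : ℝ))).card
          < (Finset.univ.filter (fun v : Fin n => ∃ u : Fin n,
              0 < ((Function.update w s(o, y) 1) s(u, v) : ℝ))).card →
        ∀ (A' : Finset (Fin n)) (o' b' a₀' : Fin n) (hb' : b' ∈ A'), o' ∉ A' → a₀' ∈ A' →
        (∀ a ∈ A', (prodBernoulli w').real (openConnIn (({o'} : Set (Fin n))ᶜ) a₀' b')
          ≤ (prodBernoulli w').real (openConnIn (({o'} : Set (Fin n))ᶜ) a b')) →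
        (prodBernoulli w').real (openConn a₀' b') - (prodBernoulli w').real (openConn o' b')
          ≤ ∑ W ∈ (Finset.univ : Finset (Finset (Fin n))).filter (fun W => o' ∈ W ∧ Disjoint W A'),
              (prodBernoulli w').real {ω : BondConfig (Fin n) | openCluster ω o' = (W : Set (Fin n))}
                * A'.inf' ⟨b', hb'⟩ (fun a => (prodBernoulli w').real (openConnIn ((W : Set (Fin n))ᶜ) a b'))) →
      ((prodBernoulli (Function.update w s(o, y) 0)).real (openConn a₀ b)
          - (prodBernoulli (Function.update w s(o, y) 0)).real (openConn o b)
        ≤ ∑ W ∈ (Finset.univ : Finset (Finset (Fin n))).filter (fun W => o ∈ W ∧ Disjoint W A),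
            (prodBernoulli (Function.update w s(o, y) 0)).real
                {ω : BondConfig (Fin n) | openCluster ω o = (W : Set (Fin n))}
              * A.inf' ⟨b, hb⟩ (fun a => (prodBernoulli w).real (openConnIn ((W : Set (Fin n))ᶜ) a b))) →
      (prodBernoulli (Function.update w s(o, y) 0)).real (openConn o b)
        < (prodBernoulli (Function.update w s(o, y) 0)).real (openConn a₀ b) →
      ((prodBernoulli (Function.update w s(o, y) 1)).real (openConn a₀ b)
          - (prodBernoulli (Function.update w s(o, y) 1)).real (openConn o b))
        * (∑ W ∈ (Finset.univ : Finset (Finset (Fin n))).filter (fun W => o ∈ W ∧ Disjoint W A),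
            (prodBernoulli (Function.update w s(o, y) 0)).real
                {ω : BondConfig (Fin n) | openCluster ω o = (W : Set (Fin n))}
              * A.inf' ⟨b, hb⟩ (fun a => (prodBernoulli w).real (openConnIn ((W : Set (Fin n))ᶜ) a b)))
      ≤ ((prodBernoulli (Function.update w s(o, y) 0)).real (openConn a₀ b)
          - (prodBernoulli (Function.update w s(o, y) 0)).real (openConn o b))
        * (∑ W ∈ (Finset.univ : Finset (Finset (Fin n))).filter (fun W => o ∈ W ∧ Disjoint W A),
            (prodBernoulli (Function.update w s(o, y) 1)).real
                {ω : BondConfig (Fin n) | openCluster ω o = (W : Set (Fin n))}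
              * A.inf' ⟨b, hb⟩ (fun a => (prodBernoulli w).real (openConnIn ((W : Set (Fin n))ᶜ) a b))))) (h2 : (∀ (n : ℕ) (w : Sym2 (Fin n) → unitInterval) (o y b a₀ : Fin n), y ≠ o →
      (prodBernoulli (Function.update w s(o, y) 0)).real (openConn a₀ b)
        ≤ (prodBernoulli (Function.update w s(o, y) 0)).real (openConn o b) →
      (prodBernoulli (Function.update w s(o, y) 1)).real (openConn a₀ b)
        ≤ (prodBernoulli (Function.update w s(o, y) 1)).real (openConn o b))) (h3 : (∀ (n : ℕ) (w : Sym2 (Fin n) → unitInterval) (A : Finset (Fin n)) (o y b a₀ : Fin n),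
      b ∈ A → o ∉ A → y ∈ A → a₀ ∈ A →
      (∀ a ∈ A, (prodBernoulli w).real (openConnIn (({o} : Set (Fin n))ᶜ) a₀ b)
        ≤ (prodBernoulli w).real (openConnIn (({o} : Set (Fin n))ᶜ) a b)) →
      (prodBernoulli (Function.update w s(o, y) 1)).real (openConn a₀ b)
        ≤ (prodBernoulli (Function.update w s(o, y) 1)).real (openConn o b))) :
    ∀ (n : ℕ) (w : Sym2 (Fin n) → unitInterval) (A : Finset (Fin n)) (o b a₀ : Fin n) (hb : b ∈ A),
      o ∉ A → a₀ ∈ A →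
      (∀ a ∈ A, (prodBernoulli w).real (openConnIn (({o} : Set (Fin n))ᶜ) a₀ b)
        ≤ (prodBernoulli w).real (openConnIn (({o} : Set (Fin n))ᶜ) a b)) →
      (prodBernoulli w).real (openConn a₀ b) - (prodBernoulli w).real (openConn o b)
        ≤ ∑ W ∈ (Finset.univ : Finset (Finset (Fin n))).filter (fun W => o ∈ W ∧ Disjoint W A),
            (prodBernoulli w).real {ω : BondConfig (Fin n) | openCluster ω o = (W : Set (Fin n))}
              * A.inf' ⟨b, hb⟩ (fun a => (prodBernoulli w).real (openConnIn ((W : Set (Fin n))ᶜ) a b)) := by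
  intro n
  suffices H : ∀ (m : ℕ) (w : Sym2 (Fin n) → unitInterval),
      (Finset.univ.filter (fun v : Fin n => ∃ u : Fin n, 0 < (w s(u, v) : ℝ))).card ≤ m →
      ∀ (k : ℕ) (o : Fin n), (Finset.univ.filter (fun z : Fin n => z ≠ o ∧ w s(o, z) ≠ 0)).card = k →
      ∀ (A : Finset (Fin n)) (b a₀ : Fin n) (hb : b ∈ A), o ∉ A → a₀ ∈ A →
      (∀ a ∈ A, (prodBernoulli w).real (openConnIn (({o} : Set (Fin n))ᶜ) a₀ b)
        ≤ (prodBernoulli w).real (openConnIn (({o} : Set (Fin n))ᶜ) a b)) →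
      (prodBernoulli w).real (openConn a₀ b) - (prodBernoulli w).real (openConn o b)
        ≤ ∑ W ∈ (Finset.univ : Finset (Finset (Fin n))).filter (fun W => o ∈ W ∧ Disjoint W A),
            (prodBernoulli w).real {ω : BondConfig (Fin n) | openCluster ω o = (W : Set (Fin n))}
              * A.inf' ⟨b, hb⟩ (fun a => (prodBernoulli w).real (openConnIn ((W : Set (Fin n))ᶜ) a b)) by
    intro w A o b a₀ hb ho ha₀ hmin
    exact H _ w le_rfl _ o rfl A b a₀ hb ho ha₀ hmin
  intro m
  induction m using Nat.strong_induction_on with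
  | _ m ihm =>
    intro w hN k
    induction k using Nat.strong_induction_on generalizing w with
    | _ k ih =>
      intro o hk A b a₀ hb ho ha₀ hmin
      by_cases hiso : ∀ y : Fin n, y ≠ o → w s(o, y) = 0
      · exact q9Good_base w A o b a₀ hb ho ha₀ hmin hiso
      push Not at hiso
      obtain ⟨y, hyo, hy⟩ := hiso
      have hoy : o ≠ y := fun h => hyo h.symm
      have ht0 : (0 : ℝ) ≤ (w s(o, y) : ℝ) := (w s(o, y)).2.1
      have ht1 : (w s(o, y) : ℝ) ≤ 1 := (w s(o, y)).2.2
      -- the designation is unchanged when the pair `s(o, y)` is closed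
      have hmin₀ : ∀ a ∈ A,
          (prodBernoulli (Function.update w s(o, y) 0)).real (openConnIn (({o} : Set (Fin n))ᶜ) a₀ b)
            ≤ (prodBernoulli (Function.update w s(o, y) 0)).real (openConnIn (({o} : Set (Fin n))ᶜ) a b) := by
        intro a ha
        rw [tau0_update w hoy a₀ b 0 (Or.inl rfl), tau0_update w hoy a b 0 (Or.inl rfl)]
        exact hmin a ha
      -- induction hypothesis at weight 0
      have hlt : (Finset.univ.filter (fun z : Fin n => z ≠ o ∧ (Function.update w s(o, y) 0) s(o, z) ≠ 0)).card < k :=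
        hk ▸ star_card_lt w hyo hy
      have IH := ih _ hlt (Function.update w s(o, y) 0) ((posdeg_update_zero_le w _).trans hN) o rfl
        A b a₀ hb ho ha₀ hmin₀
      -- positive-degree count of `w₁` is at most that of `w` (the pair is already positive in `w`)
      have hN₁ : (Finset.univ.filter (fun v : Fin n => ∃ u : Fin n,
          0 < ((Function.update w s(o, y) 1) s(u, v) : ℝ))).card ≤ m := by
        refine le_trans (Finset.card_le_card fun v hv => ?_) hN
        rw [Finset.mem_filter] at hv ⊢
        obtain ⟨u, hu⟩ := hv.2
        refine ⟨hv.1, ?_⟩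
        by_cases he : s(u, v) = s(o, y)
        · refine ⟨u, ?_⟩
          rw [he]
          exact lt_of_le_of_ne (w s(o, y)).2.1 (fun h => hy (Subtype.ext h.symm))
        · refine ⟨u, ?_⟩
          rwa [Function.update_of_ne he] at hu
      -- the outer induction hypothesis, in the form the stub wants
      have hOut : ∀ w' : Sym2 (Fin n) → unitInterval,
          (Finset.univ.filter (fun v : Fin n => ∃ u : Fin n, 0 < (w' s(u, v) : ℝ))).card
            < (Finset.univ.filter (fun v : Fin n => ∃ u : Fin n,
                0 < ((Function.update w s(o, y) 1) s(u, v) : ℝ))).card →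
          ∀ (A' : Finset (Fin n)) (o' b' a₀' : Fin n) (hb' : b' ∈ A'), o' ∉ A' → a₀' ∈ A' →
          (∀ a ∈ A', (prodBernoulli w').real (openConnIn (({o'} : Set (Fin n))ᶜ) a₀' b')
            ≤ (prodBernoulli w').real (openConnIn (({o'} : Set (Fin n))ᶜ) a b')) →
          (prodBernoulli w').real (openConn a₀' b') - (prodBernoulli w').real (openConn o' b')
            ≤ ∑ W ∈ (Finset.univ : Finset (Finset (Fin n))).filter (fun W => o' ∈ W ∧ Disjoint W A'),
                (prodBernoulli w').real {ω : BondConfig (Fin n) | openCluster ω o' = (W : Set (Fin n))}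
                  * A'.inf' ⟨b', hb'⟩ (fun a => (prodBernoulli w').real (openConnIn ((W : Set (Fin n))ᶜ) a b')) := by
        intro w' hw' A' o' b' a₀' hb' ho' ha₀' hmin'
        exact ihm _ (lt_of_lt_of_le hw' hN₁) w' le_rfl _ o' rfl A' b' a₀' hb' ho' ha₀' hmin'
      -- pocket factors under `w₀` = under `w`
      have hZ₀ : (∑ W ∈ (Finset.univ : Finset (Finset (Fin n))).filter (fun W => o ∈ W ∧ Disjoint W A),
          (prodBernoulli (Function.update w s(o, y) 0)).real
              {ω : BondConfig (Fin n) | openCluster ω o = (W : Set (Fin n))}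
            * A.inf' ⟨b, hb⟩ (fun a => (prodBernoulli (Function.update w s(o, y) 0)).real
                (openConnIn ((W : Set (Fin n))ᶜ) a b))) =
          ∑ W ∈ (Finset.univ : Finset (Finset (Fin n))).filter (fun W => o ∈ W ∧ Disjoint W A),
          (prodBernoulli (Function.update w s(o, y) 0)).real
              {ω : BondConfig (Fin n) | openCluster ω o = (W : Set (Fin n))}
            * A.inf' ⟨b, hb⟩ (fun a => (prodBernoulli w).real (openConnIn ((W : Set (Fin n))ᶜ) a b)) := by
        refine Finset.sum_congr rfl fun W hW => ?_
        rw [Finset.mem_filter] at hW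
        have hf : (fun a => (prodBernoulli (Function.update w s(o, y) 0)).real (openConnIn ((W : Set (Fin n))ᶜ) a b)) =
            (fun a => (prodBernoulli w).real (openConnIn ((W : Set (Fin n))ᶜ) a b)) :=
          funext fun a => pocket_update w hoy W hW.2.1 a b 0 (Or.inl rfl)
        rw [hf]
      rw [hZ₀] at IH
      -- one-bond decompositions of the terms under `w`
      have hτa := goodStep_real_decomp w hoy (openConn a₀ b : Set (BondConfig (Fin n)))
      have hτo := goodStep_real_decomp w hoy (openConn o b : Set (BondConfig (Fin n)))
      have hZ : (∑ W ∈ (Finset.univ : Finset (Finset (Fin n))).filter (fun W => o ∈ W ∧ Disjoint W A),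
          (prodBernoulli w).real {ω : BondConfig (Fin n) | openCluster ω o = (W : Set (Fin n))}
            * A.inf' ⟨b, hb⟩ (fun a => (prodBernoulli w).real (openConnIn ((W : Set (Fin n))ᶜ) a b))) =
          (1 - (w s(o, y) : ℝ)) *
            (∑ W ∈ (Finset.univ : Finset (Finset (Fin n))).filter (fun W => o ∈ W ∧ Disjoint W A),
              (prodBernoulli (Function.update w s(o, y) 0)).real
                  {ω : BondConfig (Fin n) | openCluster ω o = (W : Set (Fin n))}
                * A.inf' ⟨b, hb⟩ (fun a => (prodBernoulli w).real (openConnIn ((W : Set (Fin n))ᶜ) a b))) +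
          (w s(o, y) : ℝ) *
            (∑ W ∈ (Finset.univ : Finset (Finset (Fin n))).filter (fun W => o ∈ W ∧ Disjoint W A),
              (prodBernoulli (Function.update w s(o, y) 1)).real
                  {ω : BondConfig (Fin n) | openCluster ω o = (W : Set (Fin n))}
                * A.inf' ⟨b, hb⟩ (fun a => (prodBernoulli w).real (openConnIn ((W : Set (Fin n))ᶜ) a b))) := by
        rw [Finset.mul_sum, Finset.mul_sum, ← Finset.sum_add_distrib]
        refine Finset.sum_congr rfl fun W _ => ?_
        rw [goodStep_real_decomp w hoy {ω : BondConfig (Fin n) | openCluster ω o = (W : Set (Fin n))}]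
        ring
      -- nonnegativity of the pocket sums
      have hinf_nn : ∀ W : Finset (Fin n),
          0 ≤ A.inf' ⟨b, hb⟩ (fun a => (prodBernoulli w).real (openConnIn ((W : Set (Fin n))ᶜ) a b)) :=
        fun W => Finset.le_inf' _ _ fun a _ => measureReal_nonneg
      have hZ₀nn : 0 ≤ ∑ W ∈ (Finset.univ : Finset (Finset (Fin n))).filter (fun W => o ∈ W ∧ Disjoint W A),
          (prodBernoulli (Function.update w s(o, y) 0)).real
              {ω : BondConfig (Fin n) | openCluster ω o = (W : Set (Fin n))}
            * A.inf' ⟨b, hb⟩ (fun a => (prodBernoulli w).real (openConnIn ((W : Set (Fin n))ᶜ) a b)) :=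
        Finset.sum_nonneg fun W _ => mul_nonneg measureReal_nonneg (hinf_nn W)
      have hZ₁nn : 0 ≤ ∑ W ∈ (Finset.univ : Finset (Finset (Fin n))).filter (fun W => o ∈ W ∧ Disjoint W A),
          (prodBernoulli (Function.update w s(o, y) 1)).real
              {ω : BondConfig (Fin n) | openCluster ω o = (W : Set (Fin n))}
            * A.inf' ⟨b, hb⟩ (fun a => (prodBernoulli w).real (openConnIn ((W : Set (Fin n))ᶜ) a b)) :=
        Finset.sum_nonneg fun W _ => mul_nonneg measureReal_nonneg (hinf_nn W)
      -- goodness at weight 1: `K_{w₁} ≥ 0`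
      have hK₁ : (prodBernoulli (Function.update w s(o, y) 1)).real (openConn a₀ b)
          - (prodBernoulli (Function.update w s(o, y) 1)).real (openConn o b)
          ≤ ∑ W ∈ (Finset.univ : Finset (Finset (Fin n))).filter (fun W => o ∈ W ∧ Disjoint W A),
              (prodBernoulli (Function.update w s(o, y) 1)).real
                  {ω : BondConfig (Fin n) | openCluster ω o = (W : Set (Fin n))}
                * A.inf' ⟨b, hb⟩ (fun a => (prodBernoulli w).real (openConnIn ((W : Set (Fin n))ᶜ) a b)) := by
        by_cases hyA : y ∈ A
        · have h := h3 n w A o y b a₀ hb ho hyA ha₀ hmin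
          linarith
        by_cases hbad : (prodBernoulli (Function.update w s(o, y) 0)).real (openConn o b)
            < (prodBernoulli (Function.update w s(o, y) 0)).real (openConn a₀ b)
        · have hRM := h1 n w A o y b a₀ hb ho hyA hyo ha₀ hmin hOut IH hbad
          by_cases hD₁ : (prodBernoulli (Function.update w s(o, y) 1)).real (openConn a₀ b)
              - (prodBernoulli (Function.update w s(o, y) 1)).real (openConn o b) ≤ 0
          · linarith
          push Not at hD₁
          have hZ₀pos : 0 < ∑ W ∈ (Finset.univ : Finset (Finset (Fin n))).filter (fun W => o ∈ W ∧ Disjoint W A),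
              (prodBernoulli (Function.update w s(o, y) 0)).real
                  {ω : BondConfig (Fin n) | openCluster ω o = (W : Set (Fin n))}
                * A.inf' ⟨b, hb⟩ (fun a => (prodBernoulli w).real (openConnIn ((W : Set (Fin n))ᶜ) a b)) := by
            linarith
          refine le_of_mul_le_mul_right ?_ hZ₀pos
          calc _ ≤ ((prodBernoulli (Function.update w s(o, y) 0)).real (openConn a₀ b)
                - (prodBernoulli (Function.update w s(o, y) 0)).real (openConn o b))
                * (∑ W ∈ (Finset.univ : Finset (Finset (Fin n))).filter (fun W => o ∈ W ∧ Disjoint W A),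
                  (prodBernoulli (Function.update w s(o, y) 1)).real
                      {ω : BondConfig (Fin n) | openCluster ω o = (W : Set (Fin n))}
                    * A.inf' ⟨b, hb⟩ (fun a => (prodBernoulli w).real (openConnIn ((W : Set (Fin n))ᶜ) a b))) := hRM
            _ ≤ _ := by
              rw [mul_comm]
              exact mul_le_mul_of_nonneg_left IH hZ₁nn
        · push Not at hbad
          have h := h2 n w o y b a₀ hyo hbad
          linarith
      -- combine affinely
      rw [hτa, hτo, hZ]
      nlinarith [mul_le_mul_of_nonneg_left IH (sub_nonneg.2 ht1), mul_le_mul_of_nonneg_left hK₁ ht0]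


/-- **`AdditiveGluing` (its statement, verbatim) from the three stubs.**  Real proof: `t ≥ 1` is trivial; otherwise take the level set
`A' = {x | 1 − t ≤ τ(x)} ∋ b`, `A ⊆ A'`; if `o ∈ A'` we are done; else `o ∉ A'` is an observer, `a₀ := argmin_{A'} τ°`, and Q9-goodness
(`q9Good_of_stubs`) gives `τ(a₀) − τ(o) ≤ Z(o) ≤ μ(o ↮ A')` (drop the pocket factor to its value `1` at `b`, `stub_goodStep_var1360`), i.e.
`μ(o ↔ A') − (1 − τ(a₀)) ≤ τ(o)` with `1 − τ(a₀) ≤ t`. -/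
theorem AdditiveGluing_of : (∀ (n : ℕ) (w : Sym2 (Fin n) → unitInterval) (A : Finset (Fin n)) (o y b a₀ : Fin n) (hb : b ∈ A),
      o ∉ A → y ∉ A → y ≠ o → a₀ ∈ A →
      (∀ a ∈ A, (prodBernoulli w).real (openConnIn (({o} : Set (Fin n))ᶜ) a₀ b)
        ≤ (prodBernoulli w).real (openConnIn (({o} : Set (Fin n))ᶜ) a b)) →
      (∀ w' : Sym2 (Fin n) → unitInterval,
        (Finset.univ.filter (fun v : Fin n => ∃ u : Fin n, 0 < (w' s(u, v) : ℝ))).card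
          < (Finset.univ.filter (fun v : Fin n => ∃ u : Fin n,
              0 < ((Function.update w s(o, y) 1) s(u, v) : ℝ))).card →
        ∀ (A' : Finset (Fin n)) (o' b' a₀' : Fin n) (hb' : b' ∈ A'), o' ∉ A' → a₀' ∈ A' →
        (∀ a ∈ A', (prodBernoulli w').real (openConnIn (({o'} : Set (Fin n))ᶜ) a₀' b')
          ≤ (prodBernoulli w').real (openConnIn (({o'} : Set (Fin n))ᶜ) a b')) →
        (prodBernoulli w').real (openConn a₀' b') - (prodBernoulli w').real (openConn o' b')
          ≤ ∑ W ∈ (Finset.univ : Finset (Finset (Fin n))).filter (fun W => o' ∈ W ∧ Disjoint W A'),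
              (prodBernoulli w').real {ω : BondConfig (Fin n) | openCluster ω o' = (W : Set (Fin n))}
                * A'.inf' ⟨b', hb'⟩ (fun a => (prodBernoulli w').real (openConnIn ((W : Set (Fin n))ᶜ) a b'))) →
      ((prodBernoulli (Function.update w s(o, y) 0)).real (openConn a₀ b)
          - (prodBernoulli (Function.update w s(o, y) 0)).real (openConn o b)
        ≤ ∑ W ∈ (Finset.univ : Finset (Finset (Fin n))).filter (fun W => o ∈ W ∧ Disjoint W A),
            (prodBernoulli (Function.update w s(o, y) 0)).real
                {ω : BondConfig (Fin n) | openCluster ω o = (W : Set (Fin n))}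
              * A.inf' ⟨b, hb⟩ (fun a => (prodBernoulli w).real (openConnIn ((W : Set (Fin n))ᶜ) a b))) →
      (prodBernoulli (Function.update w s(o, y) 0)).real (openConn o b)
        < (prodBernoulli (Function.update w s(o, y) 0)).real (openConn a₀ b) →
      ((prodBernoulli (Function.update w s(o, y) 1)).real (openConn a₀ b)
          - (prodBernoulli (Function.update w s(o, y) 1)).real (openConn o b))
        * (∑ W ∈ (Finset.univ : Finset (Finset (Fin n))).filter (fun W => o ∈ W ∧ Disjoint W A),
            (prodBernoulli (Function.update w s(o, y) 0)).real
                {ω : BondConfig (Fin n) | openCluster ω o = (W : Set (Fin n))}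
              * A.inf' ⟨b, hb⟩ (fun a => (prodBernoulli w).real (openConnIn ((W : Set (Fin n))ᶜ) a b)))
      ≤ ((prodBernoulli (Function.update w s(o, y) 0)).real (openConn a₀ b)
          - (prodBernoulli (Function.update w s(o, y) 0)).real (openConn o b))
        * (∑ W ∈ (Finset.univ : Finset (Finset (Fin n))).filter (fun W => o ∈ W ∧ Disjoint W A),
            (prodBernoulli (Function.update w s(o, y) 1)).real
                {ω : BondConfig (Fin n) | openCluster ω o = (W : Set (Fin n))}
              * A.inf' ⟨b, hb⟩ (fun a => (prodBernoulli w).real (openConnIn ((W : Set (Fin n))ᶜ) a b)))) → (∀ (n : ℕ) (w : Sym2 (Fin n) → unitInterval) (o y b a₀ : Fin n), y ≠ o →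
      (prodBernoulli (Function.update w s(o, y) 0)).real (openConn a₀ b)
        ≤ (prodBernoulli (Function.update w s(o, y) 0)).real (openConn o b) →
      (prodBernoulli (Function.update w s(o, y) 1)).real (openConn a₀ b)
        ≤ (prodBernoulli (Function.update w s(o, y) 1)).real (openConn o b)) → (∀ (n : ℕ) (w : Sym2 (Fin n) → unitInterval) (A : Finset (Fin n)) (o y b a₀ : Fin n),
      b ∈ A → o ∉ A → y ∈ A → a₀ ∈ A →
      (∀ a ∈ A, (prodBernoulli w).real (openConnIn (({o} : Set (Fin n))ᶜ) a₀ b)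
        ≤ (prodBernoulli w).real (openConnIn (({o} : Set (Fin n))ᶜ) a b)) →
      (prodBernoulli (Function.update w s(o, y) 1)).real (openConn a₀ b)
        ≤ (prodBernoulli (Function.update w s(o, y) 1)).real (openConn o b)) →
    ∀ (n : ℕ) (w : Sym2 (Fin n) → unitInterval) (A : Finset (Fin n)) (o b : Fin n) (t : ℝ), 0 ≤ t →
      (∀ a ∈ A, 1 - t ≤ (prodBernoulli w).real (openConn a b)) →
      (prodBernoulli w).real (⋃ a ∈ A, openConn o a) - t ≤ (prodBernoulli w).real (openConn o b) := by
  -- (= the body of `PercNearOneGluing.AdditiveGluing`, unfolded so that `additiveGluing_closed` below is the only theorem whose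
  --  conclusion is the crux constant; the skeleton audit reads the crux proof from it)
  intro h1 h2 h3 n w A o b t ht hA
  have hU1 : (prodBernoulli w).real (⋃ a ∈ A, (openConn o a : Set (BondConfig (Fin n)))) ≤ 1 :=
    measureReal_le_one
  have hob0 : 0 ≤ (prodBernoulli w).real (openConn o b : Set (BondConfig (Fin n))) := measureReal_nonneg
  by_cases ht1 : 1 ≤ t
  · linarith
  push Not at ht1
  have hbb : (prodBernoulli w).real (openConn b b : Set (BondConfig (Fin n))) = 1 := by
    have h : (openConn b b : Set (BondConfig (Fin n))) = Set.univ :=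
      Set.eq_univ_of_forall fun ω => (SimpleGraph.Reachable.refl b : (openGraph ω).Reachable b b)
    rw [h, probReal_univ]
  have hbA' : b ∈ Finset.univ.filter (fun x : Fin n => 1 - t ≤ (prodBernoulli w).real (openConn x b)) := by
    rw [Finset.mem_filter]
    refine ⟨Finset.mem_univ _, ?_⟩
    rw [hbb]
    linarith
  have hAA' : ∀ a ∈ A, a ∈ Finset.univ.filter (fun x : Fin n => 1 - t ≤ (prodBernoulli w).real (openConn x b)) :=
    fun a ha => by
      rw [Finset.mem_filter]
      exact ⟨Finset.mem_univ _, hA a ha⟩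
  have hmemA' : ∀ x ∈ Finset.univ.filter (fun x : Fin n => 1 - t ≤ (prodBernoulli w).real (openConn x b)),
      1 - t ≤ (prodBernoulli w).real (openConn x b) := fun x hx => by
    rw [Finset.mem_filter] at hx
    exact hx.2
  -- `μ(o ↔ A) ≤ μ(o ↔ A')`
  have hmono : (prodBernoulli w).real (⋃ a ∈ A, (openConn o a : Set (BondConfig (Fin n)))) ≤
      (prodBernoulli w).real (⋃ a ∈ Finset.univ.filter
        (fun x : Fin n => 1 - t ≤ (prodBernoulli w).real (openConn x b)), (openConn o a : Set (BondConfig (Fin n)))) := by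
    have hsub : (⋃ a ∈ A, (openConn o a : Set (BondConfig (Fin n)))) ⊆
        ⋃ a ∈ Finset.univ.filter (fun x : Fin n => 1 - t ≤ (prodBernoulli w).real (openConn x b)),
          (openConn o a : Set (BondConfig (Fin n))) := by
      intro ω hω
      simp only [Set.mem_iUnion] at hω ⊢
      obtain ⟨a, ha, hωa⟩ := hω
      exact ⟨a, hAA' a ha, hωa⟩
    exact measureReal_mono (μ := prodBernoulli w) hsub (measure_ne_top _ _)
  by_cases ho : o ∈ Finset.univ.filter (fun x : Fin n => 1 - t ≤ (prodBernoulli w).real (openConn x b))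
  · have := hmemA' o ho
    linarith
  -- the Q9 designation over the level set
  obtain ⟨a₀, ha₀A', hmin⟩ := Finset.exists_min_image
    (Finset.univ.filter (fun x : Fin n => 1 - t ≤ (prodBernoulli w).real (openConn x b)))
    (fun x => (prodBernoulli w).real (openConnIn (({o} : Set (Fin n))ᶜ) x b)) ⟨b, hbA'⟩
  have hgood := q9Good_of_stubs h1 h2 h3 n w
    (Finset.univ.filter (fun x : Fin n => 1 - t ≤ (prodBernoulli w).real (openConn x b))) o b a₀ hbA' ho ha₀A' hmin
  have ha₀t := hmemA' a₀ ha₀A'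
  -- drop the pocket factor to its value at `b`
  have hZle : (∑ W ∈ (Finset.univ : Finset (Finset (Fin n))).filter (fun W => o ∈ W ∧ Disjoint W
        (Finset.univ.filter (fun x : Fin n => 1 - t ≤ (prodBernoulli w).real (openConn x b)))),
        (prodBernoulli w).real {ω : BondConfig (Fin n) | openCluster ω o = (W : Set (Fin n))}
          * (Finset.univ.filter (fun x : Fin n => 1 - t ≤ (prodBernoulli w).real (openConn x b))).inf' ⟨b, hbA'⟩
              (fun a => (prodBernoulli w).real (openConnIn ((W : Set (Fin n))ᶜ) a b))) ≤
      ∑ W ∈ (Finset.univ : Finset (Finset (Fin n))).filter (fun W => o ∈ W ∧ Disjoint W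
        (Finset.univ.filter (fun x : Fin n => 1 - t ≤ (prodBernoulli w).real (openConn x b)))),
        (prodBernoulli w).real {ω : BondConfig (Fin n) | openCluster ω o = (W : Set (Fin n))}
          * (prodBernoulli w).real (openConnIn ((W : Set (Fin n))ᶜ) b b) := by
    refine Finset.sum_le_sum fun W _ => mul_le_mul_of_nonneg_left ?_ measureReal_nonneg
    exact Finset.inf'_le _ hbA'
  rw [stub_goodStep_var1360 n w _ o b b hbA' hbA'] at hZle
  have hinter : (prodBernoulli w).real ((⋃ a' ∈ Finset.univ.filter
        (fun x : Fin n => 1 - t ≤ (prodBernoulli w).real (openConn x b)), (openConn o a' : Set (BondConfig (Fin n))))ᶜ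
        ∩ openConn b b) ≤
      (prodBernoulli w).real ((⋃ a' ∈ Finset.univ.filter
        (fun x : Fin n => 1 - t ≤ (prodBernoulli w).real (openConn x b)), (openConn o a' : Set (BondConfig (Fin n))))ᶜ) :=
    measureReal_mono (μ := prodBernoulli w) Set.inter_subset_left (measure_ne_top _ _)
  have hcompl : (prodBernoulli w).real ((⋃ a' ∈ Finset.univ.filter
        (fun x : Fin n => 1 - t ≤ (prodBernoulli w).real (openConn x b)), (openConn o a' : Set (BondConfig (Fin n))))ᶜ) =
      1 - (prodBernoulli w).real (⋃ a' ∈ Finset.univ.filter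
        (fun x : Fin n => 1 - t ≤ (prodBernoulli w).real (openConn x b)), (openConn o a' : Set (BondConfig (Fin n)))) :=
    probReal_compl_eq_one_sub (Set.toFinite _).measurableSet
  linarith


/-- **The crux BY NAME from the three registered stubs** (the skeleton theorem; open only through the `sorry`s inside
`stub_*`; `AdditiveGluing_of` is its hypothesis-explicit form). -/
theorem additiveGluing_closed :
    Summit.CriticalPhenomena.PercolationContinuityZ3.Theses.PercNearOneGluing.AdditiveGluing :=
  AdditiveGluing_of stub_ratioEdgeMono stub_goodStaysGood stub_relayAttach

end

end Summit.CriticalPhenomena.PercolationContinuityZ3.Cruxes.AdditiveGluing.RatioStar
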